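import Literature.NumberTheory.GaloisRepresentations.IdeleClassH2Sequence
import Literature.NumberTheory.Automorphic.IdeleClassGroupFirstCohomology
import Literature.Algebra.Homology.CoinducedConjugation
import HarnessLib

/-!
# Inflation `Hⁿ(Gal(E/F), J_E) → Hⁿ(Gal(E'/F), J_{E'})` in a tower `F ⊆ E ⊆ E'` of Galois extensions, and its
# compatibility with `Eˣ → J_E → C_E` (Tate, C–F VII §8, §11.1; Serre, *Local Fields* XI §2–§3)

Topic `NumberTheory/GaloisRepresentations`; namespace `Literature.NumberTheory.GaloisRepresentations.IdeleCohomology`,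
continuing `IdeleClassH2Sequence.lean` (`brauerToIdele : H²(G, Eˣ) ⟶ H²(G, J_E)`, `ideleToClass : H²(G, J_E) ⟶ H²(G, C_E)`)
with the tree's base change of idèles `AdeleRing.ideleBaseChange E E' : J_E →* J_{E'}` (`Automorphic/AdeleBaseChange`),
its `Gal(E'/F)`-equivariance `AdeleRing.smul_ideleBaseChange_tower` (`Automorphic/IdeleNormTowerProofs`) and the idèle
class base change `classBaseChange E E'` with `classGalAct_classBaseChange_tower`.  Definitions with
bodies (`unitsInflHom`, `ideleInflHom`, `classInflHom`, `unitsInf`, `ideleInf`, `classInf`) and theorems; NO named fact,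
no `sorry`, no instance, no notation; number fields in `Type`.

Mathematics.  For number fields `F ⊆ E ⊆ E'` with `E/F`, `E'/F` Galois, `res : Gal(E'/F) ↠ Gal(E/F)` (Mathlib
`AlgEquiv.restrictNormalHom E`) and the inclusions `Eˣ ⊆ E'ˣ`, `J_E ⊆ J_{E'}` (`x ↦ x ⊗ 1`), `C_E → C_{E'}`, which are
morphisms of pairs `(Gal(E'/F), ·_{E'}) → (Gal(E/F), ·_E)`; they induce the INFLATION maps
`Inf : Hⁿ(Gal(E/F), A_E) → Hⁿ(Gal(E'/F), A_{E'})` for `A = (·)ˣ, J, C` (Mathlib `groupCohomology.map res ι n`), and the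
three inflations commute with `H²(Eˣ → J_E)` and `H²(J_E → C_E)` (Tate VII §11.1: for `E/L/K` "we have an exact commutative
diagram" whose vertical lines are the inflation-restriction sequences of `L* → J_L → C_L`).  Here the three pair morphisms are packaged as morphisms `Res_{res}(A_E) ⟶ A_{E'}` in `Rep ℤ Gal(E'/F)` and
the two commuting squares are proved; door-c4's `IdeleClassGaloisRepInflation` uses the same `classBaseChange` for
`Inf u_E = [E':E] · u_{E'}`.

## What is formalised

* §1 `unitsInflHom`, `ideleInflHom`, `classInflHom` (the pair morphisms over `res`), with `_hom_apply` lemmas;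
  `res_principalRepHom_comp_ideleInflHom` (`Eˣ → J` square), `res_classRepHom_comp_classInflHom` (`J → C` square).
* §2 `unitsInf n`, `ideleInf n`, `classInf n` (the inflations on `Hⁿ`); **`ideleInf_brauerToIdele`**
  (`Inf ∘ H²(Eˣ → J_E) = H²(E'ˣ → J_{E'}) ∘ Inf`) and **`classInf_ideleToClass`** (`Inf ∘ H²(J_E → C_E) = H²(J_{E'} → C_{E'}) ∘ Inf`).

Not here: the compatibility of `ideleInf` with the place projections / local invariants (next file).

## References
* J. W. S. Cassels, A. Fröhlich (eds.), *Algebraic Number Theory* (1967), Ch. VII (Tate) §8, §11.1 (the exact commutative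
  diagram of a tower). [CasselsFrohlichANT1967]
* J.-P. Serre, *Local Fields*, GTM 67 (1979), Ch. XI §1–§3 (`Inf`, `Res` on the layers of a formation). [SerreLocalFields1979]
-/

-- CITATION-FIX (2026-08-27, door-c5 g15; referee Q-g51-2 locus 2; held copy `book:editornd-algebraic-number-theory`):
-- earlier revisions attributed the two commuting squares to "Tate VII §11.2 diagram (6)" with a phrase in quotation marks
-- that is not Tate's — diagram (6) [held p0233] is the complex `0 → H²(L, K̄*) → H²(L, J_K̄) → ℚ/ℤ` and has no vertical
-- arrows; the printed home of the squares is §11.1 [held p0232]: "we have an exact commutative diagram" (verbatim), its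
-- vertical lines being inflation-restriction sequences.  Locators re-pointed to §11.1; declarations unchanged.

noncomputable section

open NumberField IsDedekindDomain CategoryTheory CategoryTheory.Limits groupCohomology
open Literature.NumberTheory.Automorphic

namespace Literature.NumberTheory.GaloisRepresentations

namespace IdeleCohomology

open Literature.Algebra.Homology

variable {F E E' : Type} [Field F] [NumberField F] [Field E] [NumberField E] [Field E'] [NumberField E']
  [Algebra F E] [Algebra E E'] [Algebra F E'] [IsScalarTower F E E'] [Normal F E]

/-! ## §1. The pair morphisms `Eˣ → E'ˣ`, `J_E → J_{E'}`, `C_E → C_{E'}` over `res : Gal(E'/F) → Gal(E/F)` -/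

variable (F E E') in
/-- **`Eˣ → E'ˣ` as a morphism `Res_{res}(Eˣ) ⟶ E'ˣ` of `Gal(E'/F)`-modules** (`τ(x) = (τ|_E)(x)` for `x ∈ E`).
[cite: CasselsFrohlichANT1967, Ch. VII §11.2] -/
def unitsInflHom :
    Rep.res (AlgEquiv.restrictNormalHom E) (Rep.ofAlgebraAutOnUnits F E) ⟶ Rep.ofAlgebraAutOnUnits F E' :=
  Rep.ofHom (LinearMap.intertwiningMap_of_isIntertwiningMap _ _
    (MonoidHom.toAdditive (Units.map (algebraMap E E').toMonoidHom)).toIntLinearMap fun τ x => by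
      apply (Additive.toMul (α := E'ˣ)).injective
      refine Units.ext ?_
      change algebraMap E E' (((AlgEquiv.restrictNormalHom E τ) • (Additive.toMul x : Eˣ) : Eˣ) : E) =
        ((τ • (Units.map (algebraMap E E').toMonoidHom (Additive.toMul x) : E'ˣ) : E'ˣ) : E')
      rw [AlgEquiv.smul_units_def, AlgEquiv.smul_units_def, Units.coe_map, Units.coe_map, Units.coe_map,
        MonoidHom.coe_coe, MonoidHom.coe_coe, RingHom.toMonoidHom_eq_coe, MonoidHom.coe_coe]
      exact AlgEquiv.restrictNormal_commutes τ E _)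

omit [NumberField F] [NumberField E] [NumberField E'] in
/-- Unfolding `unitsInflHom` on values. [cite: CasselsFrohlichANT1967, Ch. VII §11.2] -/
theorem coe_toMul_unitsInflHom (x : Additive Eˣ) :
    ((Additive.toMul ((unitsInflHom F E E').hom x) : E'ˣ) : E') = algebraMap E E' ((Additive.toMul x : Eˣ) : E) := rfl

variable (F E E') in
/-- **`J_E → J_{E'}` (`x ↦ x ⊗ 1`) as a morphism `Res_{res}(J_E) ⟶ J_{E'}` of `Gal(E'/F)`-modules** (equivariance
`τ • x_{E'} = ((τ|_E) • x)_{E'}`, the tree's `AdeleRing.smul_ideleBaseChange_tower`). [cite: CasselsFrohlichANT1967, Ch. VII §8] -/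
def ideleInflHom :
    Rep.res (AlgEquiv.restrictNormalHom E) (IdeleClassGroup.ideleRep F E) ⟶ IdeleClassGroup.ideleRep F E' :=
  Rep.ofHom (LinearMap.intertwiningMap_of_isIntertwiningMap _ _
    (MonoidHom.toAdditive (AdeleRing.ideleBaseChange E E')).toIntLinearMap fun τ x => by
      show Additive.ofMul (AdeleRing.ideleBaseChange E E'
          (Additive.toMul ((IdeleClassGroup.ideleRep F E).ρ (AlgEquiv.restrictNormalHom E τ) x))) =
        (IdeleClassGroup.ideleRep F E').ρ τ (Additive.ofMul (AdeleRing.ideleBaseChange E E' (Additive.toMul x)))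
      rw [IdeleClassGroup.ideleRep_ρ_apply, IdeleClassGroup.ideleRep_ρ_apply]
      exact congrArg Additive.ofMul (AdeleRing.smul_ideleBaseChange_tower (K := F) τ (Additive.toMul x)).symm)

omit [NumberField F] in
/-- Unfolding `ideleInflHom`. [cite: CasselsFrohlichANT1967, Ch. VII §8] -/
theorem ideleInflHom_hom_apply (x : Additive (ideleGroup E)) :
    (ideleInflHom F E E').hom x = Additive.ofMul (AdeleRing.ideleBaseChange E E' (Additive.toMul x)) := rfl

variable (F E E') in
/-- **`C_E → C_{E'}` as a morphism `Res_{res}(C_E) ⟶ C_{E'}` of `Gal(E'/F)`-modules** (the tree's `classBaseChange E E'`,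
equivariance `classGalAct_classBaseChange_tower`; door-c4's `exists_baseChangeHom` as a definition).
[cite: CasselsFrohlichANT1967, Ch. VII §8 Prop. 8.1] -/
def classInflHom :
    Rep.res (AlgEquiv.restrictNormalHom E) (IdeleClassGroup.galoisRep F E) ⟶ IdeleClassGroup.galoisRep F E' :=
  letI : AddCommGroup (Additive (IdeleClassGroup E)) := Additive.addCommGroup
  letI : AddCommGroup (Additive (IdeleClassGroup E')) := Additive.addCommGroup
  Rep.ofHom (LinearMap.intertwiningMap_of_isIntertwiningMap _ _
    ((MonoidHom.toAdditive (classBaseChange E E')).toIntLinearMap :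
      Additive (IdeleClassGroup E) →ₗ[ℤ] Additive (IdeleClassGroup E')) fun τ x => by
      show Additive.ofMul (classBaseChange E E'
          (Additive.toMul ((IdeleClassGroup.galoisRep F E).ρ (AlgEquiv.restrictNormalHom E τ) x))) =
        (IdeleClassGroup.galoisRep F E').ρ τ
          (Additive.ofMul (classBaseChange E E' (Additive.toMul x)))
      rw [IdeleClassGroup.galoisRep_ρ_apply, IdeleClassGroup.galoisRep_ρ_apply]
      exact congrArg Additive.ofMul
        (IdeleClassGroup.classGalAct_classBaseChange_tower (F := F) τ (Additive.toMul x)).symm)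

/-- Unfolding `classInflHom`. [cite: CasselsFrohlichANT1967, Ch. VII §8 Prop. 8.1] -/
theorem classInflHom_hom_apply (x : Additive (IdeleClassGroup E)) :
    (classInflHom F E E').hom x = Additive.ofMul (classBaseChange E E' (Additive.toMul x)) := rfl

omit [NumberField F] in
/-- **The square `Eˣ → J_E`, `E'ˣ → J_{E'}`**: base change of a principal idèle is the principal idèle of the image.
[cite: CasselsFrohlichANT1967, Ch. VII §11.2] -/
theorem res_principalRepHom_comp_ideleInflHom :
    (Rep.resFunctor (AlgEquiv.restrictNormalHom E)).map (IdeleClassGroup.principalRepHom F E) ≫ ideleInflHom F E E' =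
      unitsInflHom F E E' ≫ IdeleClassGroup.principalRepHom F E' := by
  refine Rep.hom_ext (Representation.IntertwiningMap.ext (LinearMap.ext fun x => ?_))
  change Additive.ofMul (AdeleRing.ideleBaseChange E E' (IdeleHerbrand.principal E (Additive.toMul x))) =
    Additive.ofMul (IdeleHerbrand.principal E' (Additive.toMul ((unitsInflHom F E E').hom x)))
  refine congrArg Additive.ofMul (Units.ext ?_)
  change Literature.NumberTheory.Automorphic.AdeleRing.baseChange E E'
      (algebraMap E (AdeleRing (𝓞 E) E) ((Additive.toMul x : Eˣ) : E)) =
    algebraMap E' (AdeleRing (𝓞 E') E') ((Additive.toMul ((unitsInflHom F E E').hom x) : E'ˣ) : E')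
  rw [AdeleRing.baseChange_algebraMap, coe_toMul_unitsInflHom]

/-- **The square `J_E → C_E`, `J_{E'} → C_{E'}`** (`classBaseChange [x] = [x_{E'}]`).
[cite: CasselsFrohlichANT1967, Ch. VII §8 Prop. 8.1] -/
theorem res_classRepHom_comp_classInflHom :
    (Rep.resFunctor (AlgEquiv.restrictNormalHom E)).map (IdeleClassGroup.classRepHom F E) ≫ classInflHom F E E' =
      ideleInflHom F E E' ≫ IdeleClassGroup.classRepHom F E' := by
  refine Rep.hom_ext (Representation.IntertwiningMap.ext (LinearMap.ext fun x => ?_))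
  change (classInflHom F E E').hom ((IdeleClassGroup.classRepHom F E).hom x) =
    (IdeleClassGroup.classRepHom F E').hom ((ideleInflHom F E E').hom x)
  rw [classInflHom_hom_apply, IdeleClassGroup.classRepHom_apply, IdeleClassGroup.classRepHom_apply,
    ideleInflHom_hom_apply, toMul_ofMul, toMul_ofMul, classBaseChange_mk]

/-! ## §2. The inflations on `Hⁿ` and the two commuting squares -/

variable (F E E') in
/-- **`Inf : Hⁿ(Gal(E/F), Eˣ) → Hⁿ(Gal(E'/F), E'ˣ)`** (Mathlib `groupCohomology.map res (Eˣ → E'ˣ)`).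
[cite: SerreLocalFields1979, Ch. XI §3] -/
def unitsInf (n : ℕ) :
    groupCohomology (Rep.ofAlgebraAutOnUnits F E) n ⟶ groupCohomology (Rep.ofAlgebraAutOnUnits F E') n :=
  groupCohomology.map (AlgEquiv.restrictNormalHom E) (unitsInflHom F E E') n

variable (F E E') in
/-- **`Inf : Hⁿ(Gal(E/F), J_E) → Hⁿ(Gal(E'/F), J_{E'})`**. [cite: CasselsFrohlichANT1967, Ch. VII §11.2] -/
def ideleInf (n : ℕ) :
    groupCohomology (IdeleClassGroup.ideleRep F E) n ⟶ groupCohomology (IdeleClassGroup.ideleRep F E') n :=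
  groupCohomology.map (AlgEquiv.restrictNormalHom E) (ideleInflHom F E E') n

variable (F E E') in
/-- **`Inf : Hⁿ(Gal(E/F), C_E) → Hⁿ(Gal(E'/F), C_{E'})`** (door-c4's "Inf" for the idèle class layers).
[cite: CasselsFrohlichANT1967, Ch. VII §11.2] -/
def classInf (n : ℕ) :
    groupCohomology (IdeleClassGroup.galoisRep F E) n ⟶ groupCohomology (IdeleClassGroup.galoisRep F E') n :=
  groupCohomology.map (AlgEquiv.restrictNormalHom E) (classInflHom F E E') n

omit [NumberField F] in
/-- **`Inf ∘ H²(Eˣ → J_E) = H²(E'ˣ → J_{E'}) ∘ Inf`** (Tate VII §11.1, exact commutative diagram: the `L*`- and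
`J_L`-columns). [cite: CasselsFrohlichANT1967, Ch. VII §11.1] -/
theorem brauerToIdele_comp_ideleInf :
    brauerToIdele F E ≫ ideleInf F E E' 2 = unitsInf F E E' 2 ≫ brauerToIdele F E' := by
  rw [brauerToIdele, brauerToIdele, groupCohomology.functor_map, groupCohomology.functor_map, ideleInf, unitsInf,
    ← groupCohomology.map_comp, ← groupCohomology.map_comp]
  exact map_congr' (by rw [MonoidHom.id_comp, MonoidHom.comp_id]) _ _
    (fun x => congrArg (fun φ => φ.hom x) (res_principalRepHom_comp_ideleInflHom (F := F) (E := E) (E' := E'))) 2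

omit [NumberField F] in
/-- Element form of `brauerToIdele_comp_ideleInf`. [cite: CasselsFrohlichANT1967, Ch. VII §11.2] -/
theorem ideleInf_brauerToIdele (β : groupCohomology (Rep.ofAlgebraAutOnUnits F E) 2) :
    ideleInf F E E' 2 (brauerToIdele F E β) = brauerToIdele F E' (unitsInf F E E' 2 β) := by
  change (brauerToIdele F E ≫ ideleInf F E E' 2) β = (unitsInf F E E' 2 ≫ brauerToIdele F E') β
  rw [brauerToIdele_comp_ideleInf]

/-- **`Inf ∘ H²(J_E → C_E) = H²(J_{E'} → C_{E'}) ∘ Inf`** (Tate VII §11.1, exact commutative diagram: the `J_L`- and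
`C_L`-columns). [cite: CasselsFrohlichANT1967, Ch. VII §11.1] -/
theorem ideleToClass_comp_classInf :
    ideleToClass F E ≫ classInf F E E' 2 = ideleInf F E E' 2 ≫ ideleToClass F E' := by
  rw [ideleToClass, ideleToClass, groupCohomology.functor_map, groupCohomology.functor_map, ideleInf, classInf,
    ← groupCohomology.map_comp, ← groupCohomology.map_comp]
  exact map_congr' (by rw [MonoidHom.id_comp, MonoidHom.comp_id]) _ _
    (fun x => congrArg (fun φ => φ.hom x) (res_classRepHom_comp_classInflHom (F := F) (E := E) (E' := E'))) 2

/-- Element form of `ideleToClass_comp_classInf`. [cite: CasselsFrohlichANT1967, Ch. VII §11.2] -/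
theorem classInf_ideleToClass (c : groupCohomology (IdeleClassGroup.ideleRep F E) 2) :
    classInf F E E' 2 (ideleToClass F E c) = ideleToClass F E' (ideleInf F E E' 2 c) := by
  change (ideleToClass F E ≫ classInf F E E' 2) c = (ideleInf F E E' 2 ≫ ideleToClass F E') c
  rw [ideleToClass_comp_classInf]

end IdeleCohomology

end Literature.NumberTheory.GaloisRepresentations

end
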